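import Summits.ResolutionOfSingularities.ResolutionOfSingularities.Theorems.PAlterationPialtTameLU
import HarnessLib

/-!
# `Pialt` (crux stmt-ResolutionOfSingularities-0555), line `SketchIdeator2`: a locally uniformizable valuation ring contains a regular affine model

Stub `exists_regularModel_of_isLocallyUniformizable` (W2b of the lead's RRLU1 programme) of the
lead's skeleton `radicially-regular-endgame` (helper file,
`--supports stmt-ResolutionOfSingularities-0555`; does not close the item).

**Statement.** If a valuation ring `O` of `K` is locally uniformizable over `k`
(`IsLocallyUniformizable k K O`: some finitely generated `k`-subalgebra `A ⊆ O` with `Frac A = K`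
is regular at the centre `𝔪_O ∩ A`), then `O` contains a finitely generated `k`-subalgebra
`B` with `Frac B = K` that is a regular ring EVERYWHERE (`IsRegularRing B`).

**Proof.** The centre `𝔭 = 𝔪_O ∩ A` lies in the regular locus of `A`, which is open since fields
are J-2; so some `g ∈ A` off the centre has `D(g) ⊆ Reg(A)`
(`exists_not_mem_forall_mem_regularLocus`, V1 of `PAlterationPialtTameLU.lean`). As `g ∉ 𝔪_O`,
`g` is a unit of `O`, hence `B := A[1/g] ⊆ O` (`locAway_le_valuationSubring`); `B` is finitely
generated (`fg_locAway`), `Frac B = K` (`isFractionRing_of_le`), and `B` is the localisation of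
the Noetherian ring `A` away from `g` all of whose local rings `A_Q`, `g ∉ Q`, are regular, so
`B` is a regular ring (`isRegularRing_of_isLocalization_away`). This is the block of
`exists_rrModel_le_of_temkin2013` (V3) with `L := K`, `O' := O`, minus the Frobenius sandwich.
-/

set_option linter.dupNamespace false -- mandated namespace of this single-conjunct summit

noncomputable section

open CategoryTheory AlgebraicGeometry IsLocalRing
open Literature.AlgebraicGeometry.Resolution

namespace Summit.ResolutionOfSingularities.ResolutionOfSingularities.Theorems.Pialt.RadiciallyRegular

/-- **A locally uniformizable valuation ring contains a finitely generated REGULAR affine model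
of `K`.** If `O` is locally uniformizable over `k` — some finitely generated `A ⊆ O` with
`Frac A = K` is regular at the centre `𝔪_O ∩ A` — then there is a finitely generated
`k`-subalgebra `B ⊆ O` with `Frac B = K` and `B` a regular ring: the regular locus of `A` is
open (fields are J-2), so some `g ∈ A` off the centre has `D(g) ⊆ Reg(A)`, and
`B := A[1/g] ⊆ O` (`g` is a unit of `O`) works. [cite: Matsumura1987, §30, Cor. to Thm. 30.5] -/
theorem exists_regularModel_of_isLocallyUniformizable (k K : Type) [Field k] [Field K]
    [Algebra k K] (O : ValuationSubring K) (h : IsLocallyUniformizable k K O) :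
    ∃ B : Subalgebra k K, B.toSubring ≤ O.toSubring ∧ B.FG ∧ IsFractionRing B K ∧
      IsRegularRing B := by
  -- adapted from `exists_rrModel_le_of_temkin2013` (PAlterationPialtTameLU.lean) with `L := K`
  obtain ⟨A, hAO, hAfg, hAfr, hreg⟩ := h
  haveI := hAfr
  haveI : Algebra.FiniteType k A := A.fg_iff_finiteType.mp hAfg
  -- the centre `𝔭 = 𝔪_O ∩ A` lies in the regular locus of `A`
  let 𝔭 : PrimeSpectrum A :=
    ⟨Ideal.comap (Subring.inclusion hAO) (maximalIdeal O), Ideal.comap_isPrime _ _⟩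
  have h𝔭 : 𝔭 ∈ regularLocus A := hreg
  obtain ⟨g, hg𝔭, hgreg⟩ := exists_not_mem_forall_mem_regularLocus k A 𝔭 h𝔭
  -- `g` is a unit of `O`
  have hgO : (g : K) ∈ O := hAO g.2
  have hgmax : (⟨(g : K), hgO⟩ : O) ∉ maximalIdeal O := hg𝔭
  have hg0 : (g : K) ≠ 0 := by
    intro h
    apply hgmax
    have : (⟨(g : K), hgO⟩ : O) = 0 := Subtype.ext h
    rw [this]
    exact zero_mem _
  have hval : O.valuation (g : K) = 1 := by
    have h1 : O.valuation ((⟨(g : K), hgO⟩ : O) : K) ≤ 1 := O.valuation_le_one _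
    have h2 : ¬ O.valuation ((⟨(g : K), hgO⟩ : O) : K) < 1 := fun h =>
      hgmax ((O.valuation_lt_one_iff _).mpr h)
    exact le_antisymm h1 (not_lt.mp h2)
  -- `B := A[1/g] ⊆ O`, a finitely generated regular affine model of `K`
  refine ⟨locAway A (g : K) g.2, locAway_le_valuationSubring hAO hval, fg_locAway hg0 hAfg,
    isFractionRing_of_le le_locAway hAfr, ?_⟩
  letI := (Subalgebra.inclusion
    (le_locAway (B := A) (f := (g : K)) (hf := g.2))).toRingHom.toAlgebra
  haveI : IsLocalization.Away (⟨(g : K), g.2⟩ : A) (locAway A (g : K) g.2) :=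
    isLocalization_locAway hg0
  haveI : IsNoetherianRing A := Algebra.FiniteType.isNoetherianRing k A
  exact isRegularRing_of_isLocalization_away (C := A) (g := (⟨(g : K), g.2⟩ : A))
    (fun Q _ hQ => hgreg ⟨Q, ‹_›⟩ hQ) (locAway A (g : K) g.2)

end Summit.ResolutionOfSingularities.ResolutionOfSingularities.Theorems.Pialt.RadiciallyRegular

end
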